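import Summits.BirchSwinnertonDyer.BirchSwinnertonDyer.Theorems.PrintX9ResplitClosersCoherentPair
import HarnessLib

set_option linter.dupNamespace false -- nested cell layout (D-0017)
set_option autoImplicit false

/-!
# PrintX9 — the (F-411) entry glue `HowardContainmentLightFramePinnedOfPrintSharpOfPrintMu` holds (plan g12 round-2 turnkey)

Closes the route item `Summit.BirchSwinnertonDyer.BirchSwinnertonDyer.Theses.PrintX9.HowardContainmentLightFramePinnedOfPrintSharpOfPrintMu`
(`MuInequalityCoherentPairOfPrint → HowardDVRKolyvaginBound → CGLSHeegnerKolyvaginSystem → HowardContainmentLightFramePinnedOfPrintSharp`)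
AT ONCE: modus ponens into the landed chain 27077 ⟸ 22642 (p650959,
`PrintX9Resplit.howardContainmentLightFramePinnedOfPrintSharp_of_muInequalityCoherentPair`).  THEOREMS ONLY; no `sorry`.
CHECK ONLY AFTER the round-2 `route edit` has landed (the decl does not exist in the route file before).
Propose: `ledger propose --kind proof --target Summits/BirchSwinnertonDyer/BirchSwinnertonDyer/Theorems/PrintX9PrintMuEntry.lean
--file PrintX9PrintMuEntry.lean --workitem <item id of HowardContainmentLightFramePinnedOfPrintSharpOfPrintMu>`.
Honest framing: bookkeeping; Howard 2004 Thm. 1.6.1 and CGLS22 Thm. 4.1.1 stay HYPOTHESES (cite-only); BSD is NOT proved by this.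
[cite: Howard2004HeegnerKolyvagin, Thm. 1.6.1] [cite: CastellaGrossiLeeSkinner2022, Thm. 4.1.1]
-/

namespace Summit.BirchSwinnertonDyer.BirchSwinnertonDyer.Theorems.PrintX9PrintMuEntry

open Summit.BirchSwinnertonDyer.BirchSwinnertonDyer.Theses.PrintX9

/-- **The (F-411) entry glue of PrintX9 holds** (one line over p650959). -/
theorem howardContainmentLightFramePinnedOfPrintSharpOfPrintMu_holds :
    HowardContainmentLightFramePinnedOfPrintSharpOfPrintMu :=
  fun hM hH hK =>
    Summit.BirchSwinnertonDyer.BirchSwinnertonDyer.Theorems.PrintX9Resplit.howardContainmentLightFramePinnedOfPrintSharp_of_muInequalityCoherentPair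
      (hM hH hK)

/-- Bridge: the round-1 crux (23088) closes the round-2 crux. -/
theorem muInequalityCoherentPairOfPrint_of_ofHoward (h : MuInequalityCoherentPairOfHoward) :
    MuInequalityCoherentPairOfPrint :=
  fun hH _ => h hH

end Summit.BirchSwinnertonDyer.BirchSwinnertonDyer.Theorems.PrintX9PrintMuEntry
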